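/-
Origin: expansion seat `planner-pub-hodgecm-pv02-g8-0`, handover #5 2026-08-18T15:33:44Z (md5 f513a6cc6c577c42f68dd8c90d2a0d9e, 399 l., 51 decls; NEW additive KERNEL leaf; imports my #3 + pv14-g6's RUN-31 row `SchwartzLinearFlowDeriv` (t31-pv14g6 row 1, src md5 7563deb5) + tree HodgeCM.Automorphic.SchwartzWeilLevi (pv14-g6, RUN 30) + Mathlib.Analysis.SpecialFunctions.Exponential => TWO rewrites `import Pv02g8.WeilThetaModelAdjoinCenter` -> `import HodgeCM.Autom (`HOME/pub-hodgecm-pv02-g8/lean/Pv02g8/WeilThetaModelLevi.lean`, md5 f513a6cc, 399 lines);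
landed by the gen-8 packager in gate run 31 as `HodgeCM/Automorphic/WeilThetaModelLevi.lean` (import ^import Pv02g8\.WeilThetaModelAdjoinCenter[ \t]*$→import HodgeCM.Automorphic.WeilThetaModelAdjoinCenter ×1; import ^import Pv14g6\.SchwartzLinearFlowDeriv[ \t]*$→import HodgeCM.Automorphic.SchwartzLinearFlowDeriv ×1).
-/
import Summits.HodgeConjecture.HodgeCM.Automorphic.WeilThetaModelAdjoinCenter
import Summits.HodgeConjecture.HodgeCM.Automorphic.SchwartzLinearFlowDeriv_2
import Summits.HodgeConjecture.HodgeCM.Automorphic.SchwartzWeilLevi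
import Mathlib.Analysis.SpecialFunctions.Exponential

/-
  HodgeCM/Automorphic/WeilThetaModelLevi.lean   (seat of origin: pub-hodgecm-pv02-g8, DAG-NODE PROVER #02 gen 8,
  lane (A); WIP module `Pv02g8.WeilThetaModelLevi`, session planner-pub-hodgecm-pv02-g8-0, 2026-08-18).  PACKAGER:
  TWO rewrites — `import Pv02g8.WeilThetaModelAdjoinCenter` ↦ `import HodgeCM.Automorphic.WeilThetaModelAdjoinCenter`
  (this seat's handover #3), `import Pv14g6.SchwartzLinearFlowDeriv` ↦ `import HodgeCM.Automorphic.SchwartzLinearFlowDeriv`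
  (pv14-g6 RUN-31 row 1, src 7563deb5); `SchwartzWeilLevi` is pv14-g6's RUN-30 tree file.  Lands AFTER all three.
  KERNEL only: nothing cited enters as a hypothesis, nothing is asserted, no placeholders.
-/

/-!
# The Levi Weil theta model: the whole of `GL(V)` adjoined, and the `smooth` clause along every `exp(sX)`

Handover #4 (`WeilThetaModelDilation`) adjoined the dilations to the Heisenberg group.  This file adjoins the whole
LEVI FACTOR `GL(V)` of the Siegel parabolic at once — pv14-g6's `Heis.leviAut : GL(V) →* Aut(Heis V)`,
`λ_A(a, b, u) = (A a, ᵗA⁻¹ b, u)`, `leviUnit : GL(V) →* GL(𝓢(V, ℂ))`, `L_A Φ = Φ ∘ A⁻¹`, and `intertwines_levi`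
(`SchwartzWeilLevi`, RUN 30) — through handover #3's `adjoinCenterModel`:
* §1 `GLd V` = `GL(V)` with the DISCRETE topology (type synonym; `GLd.of`, `GLd.toCLE`); `glAut`, `glOp`,
  `gl_intertwines`; `Heis V ⋊[glAut V] GLd V` is a topological group.
* §2 **`leviModel V L m Γz hΓz : WeilThetaModel U(1) Γz (Heis V ⋊[glAut V] GLd V) (inl(arith L m))`** — every field
  a theorem, `SK = univ`, `ω(inl h) = ρ_m(h)`, `ω(inr (GLd.of A)) Φ = Φ ∘ A⁻¹`, `ω` multiplicative.
* §3 the `smooth` clause along ANY family `s ↦ A(s) ∈ GL(V)`, `A(0) = 1`, such that `s ↦ A(s)⁻¹ ∈ End(V)` has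
  operator-norm derivative `Y` at `0`: `s ↦ ω(inr A(s)) Φ` has `SK`-derivative `flowGen Y Φ = (x ↦ DΦ(x)[Y x])` at
  `0` IN THE SCHWARTZ TOPOLOGY (`hasSKDerivAt_leviModel_of`; pv14-g6 `tendsto_compCLM_sub_div_ofReal`), and at
  every `s₀` along a one-parameter subgroup (`hasSKDerivAt_leviModel_of_at`).
* §4 `expGL V X s = exp(sX) ∈ GL(V)` for EVERY `X ∈ End(V) = Lie(GL(V))` (Mathlib's `NormedSpace.exp` in the Banach
  algebra `End(V)`: group law, inverse, operator-norm derivative `X` at `0`): **every Schwartz vector is a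
  differentiable vector of `leviModel` along every direction of the Levi Lie algebra, with derivative
  `flowGen (-X) Φ = -DΦ(x)[Xx]`** (`hasSKDerivAt_leviModel_exp`, `_exp_at`, literal `smooth`-clause shape
  `tendsto_leviModel_exp_sub_smul`), jointly with the Heisenberg directions (`hasSKDerivAt_leviModel_heis_mul_exp`).
* §5 the theta kernel differentiated along `exp(sX)` (`hasDerivAt_θ_leviModel_exp`, pv02-g7 `hasDerivAt_θ_apply`)
  and, as a structural COROLLARY, differentiation under the bare theta series along every linear flow:
  `d/ds|_{s₀} Σ_{v ∈ L} Φ(exp(sX) v) = Σ_{v ∈ L} (DΦ[X·])(exp(s₀X) v)` (`hasDerivAt_tsum_schwartz_linearFlow`).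

For [SETUP D5′] / pv06-g7's `HypSmoothSide.hF` (one HYPERBOLIC direction per place of type `Σ₁₂`): when the
hyperbolic element acts on the base space by a linear flow `exp(sJ)` (pv14-g6 `SchwartzHyperbolicFlow`, `J² = 1`)
the clause is `hasSKDerivAt_leviModel_exp` with `X := J`.  HONEST LABEL.  (i) `GLd V` is DISCRETE: joint
continuity of `ω` in `(A, Φ)` for the Lie topology of `GL(V)` (Weil n° 39) is not claimed; the derivative statements
concern the real parameter `s` only.  (ii) Levi elements do NOT fix the theta distribution of `L` unless they preserve
`L`; they are adjoined as ACTING operators ([SETUP D5′]), `rat = thetaStabSD`.  (iii) Toy real place: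
`Heis V ⋊ GL(V)` inside the Jacobi group of `Sp(V ⊕ V)`, not `U(W_b)(L_v) ≅ U(2,1)`; the dictionary with `X₁ ∈ 𝔭_b`
(pv06 / pv12, print) is not formalised here.  Nothing of PerL, QW8 or the 2001 programme is used or claimed.
-/

set_option autoImplicit false

noncomputable section

open Topology Filter

open scoped RealInnerProductSpace SchwartzMap

namespace HodgeCM
namespace SchwartzWeil

/-! ## 1. `GL(V)` with the discrete topology; the Levi action and the Levi operators on it -/

/-- The group `GL(V) = (V ≃L[ℝ] V)` with the DISCRETE topology (type synonym). -/
def GLd (V : Type*) [NormedAddCommGroup V] [NormedSpace ℝ V] : Type _ := V ≃L[ℝ] V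

namespace GLd

variable {V : Type*} [NormedAddCommGroup V] [NormedSpace ℝ V]

/-- (Ported verbatim from the HodgeCMPerL package; no docstring in the source.) -/
instance instGroup : Group (GLd V) := inferInstanceAs (Group (V ≃L[ℝ] V))

/-- (Ported verbatim from the HodgeCMPerL package; no docstring in the source.) -/
instance instTopologicalSpace : TopologicalSpace (GLd V) := ⊥

/-- (Ported verbatim from the HodgeCMPerL package; no docstring in the source.) -/
instance instDiscreteTopology : DiscreteTopology (GLd V) := ⟨rfl⟩

/-- `A ∈ GL(V)` as an element of `GLd V`. -/
def of : (V ≃L[ℝ] V) →* GLd V where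
  toFun A := A
  map_one' := rfl
  map_mul' _ _ := rfl

/-- An element of `GLd V` as a continuous linear automorphism of `V`. -/
def toCLE : GLd V →* (V ≃L[ℝ] V) where
  toFun g := g
  map_one' := rfl
  map_mul' _ _ := rfl

/-- (Ported verbatim from the HodgeCMPerL package; no docstring in the source.) -/
@[simp] theorem toCLE_of (A : V ≃L[ℝ] V) : toCLE (of A) = A := rfl

/-- (Ported verbatim from the HodgeCMPerL package; no docstring in the source.) -/
@[simp] theorem of_toCLE (g : GLd V) : of (toCLE g) = g := rfl

end GLd

section Aut

variable (V : Type) [NormedAddCommGroup V] [InnerProductSpace ℝ V] [FiniteDimensional ℝ V]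

/-- The Levi action `GLd V →* MulAut (Heis V)`, `A ↦ λ_A = ((a, b, u) ↦ (A a, ᵗA⁻¹ b, u))` (pv14-g6 `Heis.leviAut`). -/
def glAut : GLd V →* MulAut (Heis V) := (Heis.leviAut (V := V)).comp GLd.toCLE

/-- (Ported verbatim from the HodgeCMPerL package; no docstring in the source.) -/
theorem glAut_apply (g : GLd V) : glAut V g = Heis.leviAut (GLd.toCLE g) := rfl

/-- The Levi action fixes the centre pointwise. -/
theorem glAut_center (g : GLd V) (z : Circle) : glAut V g (Heis.center z) = Heis.center z :=
  Heis.leviAut_center (GLd.toCLE g) z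

/-- Each `λ_A` is continuous. -/
theorem continuous_glAut (g : GLd V) : Continuous (glAut V g : Heis V → Heis V) :=
  Heis.continuous_mk ((GLd.toCLE g).continuous.comp Heis.continuous_a)
    ((Heis.contragredient (GLd.toCLE g)).continuous_of_finiteDimensional.comp Heis.continuous_b) Heis.continuous_u

/-- (Ported verbatim from the HodgeCMPerL package; no docstring in the source.) -/
instance isTopologicalGroup_heisSD_gl : IsTopologicalGroup (Heis V ⋊[glAut V] GLd V) :=
  HeisSD.isTopologicalGroup (continuous_glAut V)

/-- The Levi operators `GLd V →* GL(𝓢(V, ℂ))`, `A ↦ L_A = (Φ ↦ Φ ∘ A⁻¹)` (pv14-g6 `leviUnit`). -/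
def glOp : GLd V →* (𝓢(V, ℂ) →L[ℂ] 𝓢(V, ℂ))ˣ := (leviUnit V).comp GLd.toCLE

omit [FiniteDimensional ℝ V] in
/-- (Ported verbatim from the HodgeCMPerL package; no docstring in the source.) -/
theorem glOp_val (g : GLd V) : (glOp V g : 𝓢(V, ℂ) →L[ℂ] 𝓢(V, ℂ)) = leviCLM V (GLd.toCLE g) := rfl

omit [FiniteDimensional ℝ V] in
/-- (Ported verbatim from the HodgeCMPerL package; no docstring in the source.) -/
theorem glOp_of_val (A : V ≃L[ℝ] V) :
    (glOp V (GLd.of A) : 𝓢(V, ℂ) →L[ℂ] 𝓢(V, ℂ)) = SchwartzMap.compCLMOfContinuousLinearEquiv ℂ A.symm := rfl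

omit [FiniteDimensional ℝ V] in
/-- (Ported verbatim from the HodgeCMPerL package; no docstring in the source.) -/
@[simp] theorem glOp_of_val_apply (A : V ≃L[ℝ] V) (Φ : 𝓢(V, ℂ)) (x : V) :
    (glOp V (GLd.of A) : 𝓢(V, ℂ) →L[ℂ] 𝓢(V, ℂ)) Φ x = Φ (A.symm x) := rfl

variable [MeasurableSpace V] [BorelSpace V] (m : ℤ)

/-- **`Intertwines V m (glAut V) (glOp V)`**: `ρ_m(λ_A h) = L_A ∘ ρ_m(h) ∘ L_A⁻¹` (pv14-g6 `intertwines_levi`). -/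
theorem gl_intertwines : Intertwines V m (glAut V) (glOp V) := fun g h => intertwines_levi V m (GLd.toCLE g) h

end Aut

/-! ## 2. The Levi Weil theta model -/

section Model

variable (V : Type) [NormedAddCommGroup V] [InnerProductSpace ℝ V] [FiniteDimensional ℝ V] [MeasurableSpace V]
  [BorelSpace V] (L : Submodule ℤ V) [DiscreteTopology L] (m : ℤ) (Γz : Subgroup Circle)
  (hΓz : ∀ z ∈ Γz, z ^ m = 1)

omit [DiscreteTopology L] in
/-- `inl(arith L m)` lies in the theta stabiliser. -/
theorem map_inl_arith_le_thetaStabSD_gl :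
    (arith V L m).map (SemidirectProduct.inl : Heis V →* Heis V ⋊[glAut V] GLd V) ≤
      thetaStabSD V L m (gl_intertwines V m) :=
  Subgroup.map_le_iff_le_comap.mpr fun _ hγ => inl_mem_thetaStabSD V L m (gl_intertwines V m) hγ

/-- **The Levi Weil theta model**: `G_U ↦ U(1)` (rational points `Γz ⊆ μ_m`), `U(W) ↦ Heis V ⋊[λ] GL(V)` — the
Heisenberg group with the whole Levi factor adjoined — ACTING through `ω = ρ_m ⋊ L` on `𝓢(V, ℂ)`,
`U(W)(L₀) ↦ inl(arith L m)`. -/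
def leviModel :
    HodgeCM.WeilThetaModel Circle Γz (Heis V ⋊[glAut V] GLd V)
      ((arith V L m).map (SemidirectProduct.inl : Heis V →* Heis V ⋊[glAut V] GLd V)) :=
  adjoinCenterModel V L m (glAut_center V) (gl_intertwines V m) Γz hΓz _ (map_inl_arith_le_thetaStabSD_gl V L m)

/-- (Ported verbatim from the HodgeCMPerL package; no docstring in the source.) -/
theorem leviModel_def : leviModel V L m Γz hΓz =
    adjoinCenterModel V L m (glAut_center V) (gl_intertwines V m) Γz hΓz _ (map_inl_arith_le_thetaStabSD_gl V L m) :=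
  rfl

/-- (Ported verbatim from the HodgeCMPerL package; no docstring in the source.) -/
@[simp] theorem leviModel_SK : (leviModel V L m Γz hΓz).SK = Set.univ := rfl

/-- (Ported verbatim from the HodgeCMPerL package; no docstring in the source.) -/
instance linearStr_leviModel : (leviModel V L m Γz hΓz).LinearStr := linearStr_adjoinCenterModel V L m _ _ Γz hΓz _ _

/-- (Ported verbatim from the HodgeCMPerL package; no docstring in the source.) -/
instance continuousSMul_leviModel : ContinuousSMul ℂ (leviModel V L m Γz hΓz).W.SX :=
  inferInstanceAs (ContinuousSMul ℂ 𝓢(V, ℂ))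

/-- (Ported verbatim from the HodgeCMPerL package; no docstring in the source.) -/
instance continuousAdd_leviModel : ContinuousAdd (leviModel V L m Γz hΓz).W.SX :=
  inferInstanceAs (ContinuousAdd 𝓢(V, ℂ))

/-- (Ported verbatim from the HodgeCMPerL package; no docstring in the source.) -/
instance t2Space_leviModel : T2Space (leviModel V L m Γz hΓz).W.SX := inferInstanceAs (T2Space 𝓢(V, ℂ))

/-- `ω(x)Φ = ρ_m(x.left) (L_{x.right} Φ)`. -/
theorem leviModel_omg (x : Heis V ⋊[glAut V] GLd V) (Φ : (leviModel V L m Γz hΓz).SK) :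
    ((leviModel V L m Γz hΓz).omg x Φ).1 = (repSD V m (gl_intertwines V m) x : 𝓢(V, ℂ) →L[ℂ] 𝓢(V, ℂ)) Φ.1 :=
  adjoinCenterModel_omg V L m _ _ Γz hΓz _ _ x Φ

/-- **The Levi factor acts through `ω`**: `ω(inr (GLd.of A)) Φ = Φ ∘ A⁻¹`. -/
theorem leviModel_omg_inr_of (A : V ≃L[ℝ] V) (Φ : (leviModel V L m Γz hΓz).SK) :
    ((leviModel V L m Γz hΓz).omg (SemidirectProduct.inr (GLd.of A)) Φ).1 =
      SchwartzMap.compCLMOfContinuousLinearEquiv ℂ A.symm Φ.1 :=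
  adjoinCenterModel_omg_inr V L m _ _ Γz hΓz _ _ (GLd.of A) Φ

/-- (Ported verbatim from the HodgeCMPerL package; no docstring in the source.) -/
theorem leviModel_omg_inr_of_mk (A : V ≃L[ℝ] V) (Φ : 𝓢(V, ℂ)) :
    (leviModel V L m Γz hΓz).omg (SemidirectProduct.inr (GLd.of A)) ⟨Φ, Set.mem_univ Φ⟩ =
      ⟨SchwartzMap.compCLMOfContinuousLinearEquiv ℂ A.symm Φ, Set.mem_univ _⟩ :=
  adjoinCenterModel_omg_inr_mk V L m _ _ Γz hΓz _ _ (GLd.of A) Φ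

/-- Heisenberg elements act by `ρ_m`. -/
theorem leviModel_omg_inl (h : Heis V) (Φ : (leviModel V L m Γz hΓz).SK) :
    ((leviModel V L m Γz hΓz).omg (SemidirectProduct.inl h) Φ).1 = repCLM V m h Φ.1 :=
  adjoinCenterModel_omg_inl V L m _ _ Γz hΓz _ _ h Φ

/-- `ω` is multiplicative. -/
theorem leviModel_omg_mul (x y : Heis V ⋊[glAut V] GLd V) (Φ : (leviModel V L m Γz hΓz).SK) :
    (leviModel V L m Γz hΓz).omg (x * y) Φ = (leviModel V L m Γz hΓz).omg x ((leviModel V L m Γz hΓz).omg y Φ) :=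
  adjoinCenterModel_omg_mul V L m _ _ Γz hΓz _ _ x y Φ

/-! ## 3. The `smooth` clause along a differentiable family in `GL(V)` -/

/-- **The `smooth` clause along any differentiable family `A : ℝ → GL(V)` with `A 0 = 1`**: if `s ↦ A(s)⁻¹` has
operator-norm derivative `Y` at `0`, then `s ↦ ω(inr A(s)) Φ` has `SK`-derivative `flowGen Y Φ` at `0`, in the
Schwartz topology, for EVERY Schwartz `Φ` (pv14-g6 `tendsto_compCLM_sub_div_ofReal`). -/
theorem hasSKDerivAt_leviModel_of {A : ℝ → (V ≃L[ℝ] V)} {Y : V →L[ℝ] V} (hA0 : A 0 = 1)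
    (hY : HasDerivAt (fun s => (((A s).symm : V ≃L[ℝ] V) : V →L[ℝ] V)) Y 0) (Φ : 𝓢(V, ℂ)) :
    (leviModel V L m Γz hΓz).HasSKDerivAt
      (fun s => (leviModel V L m Γz hΓz).omg (SemidirectProduct.inr (GLd.of (A s))) ⟨Φ, Set.mem_univ Φ⟩)
      ⟨flowGen Y Φ, Set.mem_univ _⟩ 0 := by
  refine (hasSKDerivAt_adjoinCenterModel_inr_iff V L m _ _ Γz hΓz _ _ (fun s => GLd.of (A s)) Φ _).mpr ?_
  have h0 : (((A 0).symm : V ≃L[ℝ] V) : V →L[ℝ] V) = 1 := by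
    rw [hA0]; rfl
  refine (tendsto_compCLM_sub_div_ofReal (L := fun s => (A s).symm) h0 hY Φ).congr fun s => ?_
  rw [glOp_of_val, glOp_of_val, hA0]
  rfl

/-- **Differentiability at every parameter** along a one-parameter subgroup `A` of `GL(V)`: derivative
`ω(inr A(s₀)) (flowGen Y Φ)` at `s₀`. -/
theorem hasSKDerivAt_leviModel_of_at {A : ℝ → (V ≃L[ℝ] V)} {Y : V →L[ℝ] V} (hA0 : A 0 = 1)
    (hmul : ∀ s t, A (s + t) = A s * A t)
    (hY : HasDerivAt (fun s => (((A s).symm : V ≃L[ℝ] V) : V →L[ℝ] V)) Y 0) (Φ : 𝓢(V, ℂ)) (s₀ : ℝ) :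
    (leviModel V L m Γz hΓz).HasSKDerivAt
      (fun s => (leviModel V L m Γz hΓz).omg (SemidirectProduct.inr (GLd.of (A s))) ⟨Φ, Set.mem_univ Φ⟩)
      ((leviModel V L m Γz hΓz).omg (SemidirectProduct.inr (GLd.of (A s₀))) ⟨flowGen Y Φ, Set.mem_univ _⟩) s₀ :=
  WeilThetaModel.hasSKDerivAt_orbit_of_zero (fun s => SemidirectProduct.inr (GLd.of (A s))) _ _ s₀
    (fun s => by rw [hmul, map_mul, map_mul, leviModel_omg_mul]) (hasSKDerivAt_leviModel_of V L m Γz hΓz hA0 hY Φ)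

/-- Heisenberg directions of the Levi model: derivative `dρ_m(a,b,c)Φ` (handover #3, from pv14-g6). -/
theorem hasSKDerivAt_leviModel_heis (a b : V) (c : ℝ) (Φ : 𝓢(V, ℂ)) :
    (leviModel V L m Γz hΓz).HasSKDerivAt
      (fun s => (leviModel V L m Γz hΓz).omg (SemidirectProduct.inl (Heis.expCurve a b c s)) ⟨Φ, Set.mem_univ Φ⟩)
      ⟨schrodingerGen V m a b c Φ, Set.mem_univ _⟩ 0 :=
  hasSKDerivAt_adjoinCenterModel_inl_expCurve V L m _ _ Γz hΓz _ _ a b c Φ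

end Model

/-! ## 4. The one-parameter subgroups `exp(sX)` of `GL(V)`, `X ∈ End(V)`, and the `smooth` clause along them -/

section Exp

variable (V : Type*) [NormedAddCommGroup V] [NormedSpace ℝ V] [CompleteSpace V] (X : V →L[ℝ] V)

omit [CompleteSpace V] in
/-- Every `Y ∈ End(V)` lies in the disc of convergence of the exponential series (radius `∞` over `ℝ`). -/
theorem mem_eball_expSeries (Y : V →L[ℝ] V) :
    Y ∈ Metric.eball (0 : V →L[ℝ] V) (NormedSpace.expSeries ℝ (V →L[ℝ] V)).radius :=
  (NormedSpace.expSeries_radius_eq_top ℝ (V →L[ℝ] V)).symm ▸ edist_lt_top _ _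

/-- `exp(sX) ∈ GL(V)` (`NormedSpace.exp` in the Banach algebra `End(V)`, invertible with inverse `exp(-sX)`). -/
def expGL (s : ℝ) : V ≃L[ℝ] V :=
  ContinuousLinearEquiv.unitsEquiv ℝ V (NormedSpace.isUnit_exp_of_mem_ball (mem_eball_expSeries V (s • X))).unit

/-- (Ported verbatim from the HodgeCMPerL package; no docstring in the source.) -/
@[simp] theorem coe_expGL (s : ℝ) : ((expGL V X s : V ≃L[ℝ] V) : V →L[ℝ] V) = NormedSpace.exp (s • X) := by
  ext x
  show ContinuousLinearEquiv.unitsEquiv ℝ V _ x = _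
  rw [ContinuousLinearEquiv.unitsEquiv_apply, IsUnit.unit_spec]

/-- (Ported verbatim from the HodgeCMPerL package; no docstring in the source.) -/
theorem expGL_apply (s : ℝ) (x : V) : expGL V X s x = NormedSpace.exp (s • X) x := by
  rw [← coe_expGL]; rfl

/-- (Ported verbatim from the HodgeCMPerL package; no docstring in the source.) -/
theorem expGL_zero : expGL V X 0 = 1 := by
  ext x
  rw [expGL_apply, zero_smul, NormedSpace.exp_zero]; rfl

/-- (Ported verbatim from the HodgeCMPerL package; no docstring in the source.) -/
theorem expGL_add (s t : ℝ) : expGL V X (s + t) = expGL V X s * expGL V X t := by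
  ext x
  rw [expGL_apply, add_smul, NormedSpace.exp_add_of_commute_of_mem_ball
    (((Commute.refl X).smul_left s).smul_right t) (mem_eball_expSeries V _) (mem_eball_expSeries V _)]
  show NormedSpace.exp (s • X) (NormedSpace.exp (t • X) x) = expGL V X s (expGL V X t x)
  rw [expGL_apply, expGL_apply]

/-- (Ported verbatim from the HodgeCMPerL package; no docstring in the source.) -/
theorem expGL_symm (s : ℝ) : (expGL V X s).symm = expGL V X (-s) := by
  have h : expGL V X s * expGL V X (-s) = 1 := by rw [← expGL_add, add_neg_cancel, expGL_zero]
  show (expGL V X s)⁻¹ = _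
  exact inv_eq_of_mul_eq_one_right h

/-- (Ported verbatim from the HodgeCMPerL package; no docstring in the source.) -/
theorem coe_expGL_symm (s : ℝ) :
    (((expGL V X s).symm : V ≃L[ℝ] V) : V →L[ℝ] V) = NormedSpace.exp ((-s) • X) := by
  rw [expGL_symm, coe_expGL]

/-- `exp(sX)` has operator-norm derivative `X` at `s = 0`. -/
theorem hasDerivAt_coe_expGL : HasDerivAt (fun s : ℝ => ((expGL V X s : V ≃L[ℝ] V) : V →L[ℝ] V)) X 0 := by
  have h := hasDerivAt_exp_smul_const' X (0 : ℝ)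
  rw [zero_smul, NormedSpace.exp_zero, mul_one] at h
  exact h.congr_of_eventuallyEq (Eventually.of_forall fun s => coe_expGL V X s)

/-- `exp(sX)⁻¹ = exp(-sX)` has operator-norm derivative `-X` at `s = 0`. -/
theorem hasDerivAt_coe_expGL_symm :
    HasDerivAt (fun s : ℝ => (((expGL V X s).symm : V ≃L[ℝ] V) : V →L[ℝ] V)) (-X) 0 := by
  refine (hasDerivAt_coe_expGL V (-X)).congr_of_eventuallyEq (Eventually.of_forall fun s => ?_)
  simp only [coe_expGL_symm, coe_expGL, neg_smul, smul_neg]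

end Exp

section ExpModel

variable (V : Type) [NormedAddCommGroup V] [InnerProductSpace ℝ V] [FiniteDimensional ℝ V] [MeasurableSpace V]
  [BorelSpace V] (L : Submodule ℤ V) [DiscreteTopology L] (m : ℤ) (Γz : Subgroup Circle)
  (hΓz : ∀ z ∈ Γz, z ^ m = 1)

/-- **Every Schwartz vector is a differentiable vector of the Levi model along every direction `X` of the Levi
Lie algebra `End(V)`**, in the Schwartz topology, with derivative `flowGen (-X) Φ = (x ↦ -DΦ(x)[X x])`. -/
theorem hasSKDerivAt_leviModel_exp (X : V →L[ℝ] V) (Φ : 𝓢(V, ℂ)) :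
    (leviModel V L m Γz hΓz).HasSKDerivAt
      (fun s => (leviModel V L m Γz hΓz).omg (SemidirectProduct.inr (GLd.of (expGL V X s))) ⟨Φ, Set.mem_univ Φ⟩)
      ⟨flowGen (-X) Φ, Set.mem_univ _⟩ 0 :=
  hasSKDerivAt_leviModel_of V L m Γz hΓz (expGL_zero V X) (hasDerivAt_coe_expGL_symm V X) Φ

/-- The same in the literal shape of the end-state `smooth` field:
`((s:ℝ):ℂ)⁻¹ • (ω(inr exp(sX)) Φ − Φ) ⟶ flowGen (-X) Φ` in `𝒮^κ` along `𝓝[≠] 0`. -/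
theorem tendsto_leviModel_exp_sub_smul (X : V →L[ℝ] V) (Φ : 𝓢(V, ℂ)) :
    Tendsto (fun s : ℝ => ((s : ℝ) : ℂ)⁻¹ •
        ((leviModel V L m Γz hΓz).omg (SemidirectProduct.inr (GLd.of (expGL V X s))) ⟨Φ, Set.mem_univ Φ⟩
          - ⟨Φ, Set.mem_univ Φ⟩))
      (𝓝[≠] 0) (𝓝 (⟨flowGen (-X) Φ, Set.mem_univ _⟩ : (leviModel V L m Γz hΓz).SK)) := by
  have h := WeilThetaModel.hasSKDerivAt_zero_iff_tendsto_coe_smul.mp (hasSKDerivAt_leviModel_exp V L m Γz hΓz X Φ)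
  have h0 : (leviModel V L m Γz hΓz).omg (SemidirectProduct.inr (GLd.of (expGL V X 0))) ⟨Φ, Set.mem_univ Φ⟩
      = ⟨Φ, Set.mem_univ Φ⟩ := by
    rw [expGL_zero, map_one, map_one]
    exact (leviModel V L m Γz hΓz).omg_one _
  simpa only [h0] using h

/-- **Differentiability at every parameter** along `exp(sX)`: derivative `ω(inr exp(s₀X)) (flowGen (-X) Φ)`. -/
theorem hasSKDerivAt_leviModel_exp_at (X : V →L[ℝ] V) (Φ : 𝓢(V, ℂ)) (s₀ : ℝ) :
    (leviModel V L m Γz hΓz).HasSKDerivAt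
      (fun s => (leviModel V L m Γz hΓz).omg (SemidirectProduct.inr (GLd.of (expGL V X s))) ⟨Φ, Set.mem_univ Φ⟩)
      ((leviModel V L m Γz hΓz).omg (SemidirectProduct.inr (GLd.of (expGL V X s₀)))
        ⟨flowGen (-X) Φ, Set.mem_univ _⟩) s₀ :=
  hasSKDerivAt_leviModel_of_at V L m Γz hΓz (expGL_zero V X) (expGL_add V X) (hasDerivAt_coe_expGL_symm V X) Φ s₀

/-- **The Leibniz rule on the non-commutative pair `(Heis V, GL(V))`**: along `s ↦ inl(γ_{a,b,c}(s)) · inr(exp(sX))`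
every Schwartz vector has `SK`-derivative `dρ_m(a,b,c)Φ + flowGen (-X) Φ` at `s = 0` (handover #1
`hasSKDerivAt_omg_mul_of_eq_one`, the Heisenberg factor being the continuous one). -/
theorem hasSKDerivAt_leviModel_heis_mul_exp (a b : V) (c : ℝ) (X : V →L[ℝ] V) (Φ : 𝓢(V, ℂ)) :
    (leviModel V L m Γz hΓz).HasSKDerivAt
      (fun s => (leviModel V L m Γz hΓz).omg
        (SemidirectProduct.inl (Heis.expCurve a b c s) * SemidirectProduct.inr (GLd.of (expGL V X s)))
          ⟨Φ, Set.mem_univ Φ⟩)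
      (⟨schrodingerGen V m a b c Φ, Set.mem_univ _⟩ + ⟨flowGen (-X) Φ, Set.mem_univ _⟩) 0 :=
  WeilThetaModel.hasSKDerivAt_omg_mul_of_eq_one (e₁ := fun s => SemidirectProduct.inl (Heis.expCurve a b c s))
    (e₂ := fun s => SemidirectProduct.inr (GLd.of (expGL V X s)))
    ((HeisSD.continuous_inl.comp (Heis.continuous_expCurve a b c)).continuousAt)
    (by simp only [Heis.expCurve_zero, map_one]) (by simp only [expGL_zero, map_one]) _
    (fun s => leviModel_omg_mul V L m Γz hΓz _ _ _)
    (hasSKDerivAt_leviModel_heis V L m Γz hΓz a b c Φ)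
    (hasSKDerivAt_leviModel_exp V L m Γz hΓz X Φ)

/-! ## 5. The theta kernel, and the bare theta series, differentiated along every linear flow -/

/-- **The theta kernel along `exp(sX)`**: `s ↦ θ_{ω(inr exp(sX))Φ}(q)` has derivative
`θ_{ω(inr exp(s₀X))(flowGen (-X) Φ)}(q)` at every `s₀` and every point `q` of `[U(1)] × [Heis V ⋊ GL(V)]`
(pv02-g7 `hasDerivAt_θ_apply`). -/
theorem hasDerivAt_θ_leviModel_exp (X : V →L[ℝ] V) (Φ : 𝓢(V, ℂ)) (s₀ : ℝ)
    (q : (Circle ⧸ Γz) × ((Heis V ⋊[glAut V] GLd V) ⧸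
      (arith V L m).map (SemidirectProduct.inl : Heis V →* Heis V ⋊[glAut V] GLd V))) :
    HasDerivAt
      (fun s => (leviModel V L m Γz hΓz).θ
        ((leviModel V L m Γz hΓz).omg (SemidirectProduct.inr (GLd.of (expGL V X s))) ⟨Φ, Set.mem_univ Φ⟩) q)
      ((leviModel V L m Γz hΓz).θ
        ((leviModel V L m Γz hΓz).omg (SemidirectProduct.inr (GLd.of (expGL V X s₀)))
          ⟨flowGen (-X) Φ, Set.mem_univ _⟩) q) s₀ :=
  WeilThetaModel.hasDerivAt_θ_apply (hasSKDerivAt_leviModel_exp_at V L m Γz hΓz X Φ s₀) q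


-- port_pkg: scope closed for this part
end ExpModel
end SchwartzWeil
end HodgeCM
end
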